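import Summits.Ventures.HSemireg.SecantParityWeilTypeDiscriminant
import Summits.Ventures.HSemireg.SecantParityWeilTypePolarized
import Literature.Geometry.Kaehler.ComplexTorusEllipticCurveWeilPairing
import Mathlib.RingTheory.Localization.Module
import HarnessLib

/-!
# Venture HSemireg — Markman's triple `(X × X̂, K, N·(±Ξ_d))` is of SPLIT Weil type in the sense of [Mar25b §1.1]:
# the Hermitian form `H` has an ISOTROPIC `K`-subspace of half the dimension — `K ⊗ L` for a Lagrangian `L ⊂ H₁(X, ℚ)` of `b`
# — and the hypothesis-free corollaries «`±η` a Riemann form ⇒ split triple» (with XIId); TRACK S4-PUSH (ii), seat `s4-prove-1` (g13); file XIIf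
# (sequel of XIId `SecantParityWeilTypePolarized` and XIIe `SecantParityWeilTypeDiscriminant`), record `s4push/prove-1/ATTEMPT-16.md` (16d)(16f)

HONEST FRAMING. Lean index of the computation cell `pub-hsemireg`; OBJECT LEVEL as in files XII ∕ XIIb∕c ∕ XIId ∕ XIIe: the complex
torus `X = E/Φ(ℤ^ι)`, `X × X̂ = prodPeriod Φ (dualPeriod Φ)`, `η ∈ NS(X)` non-degenerate with integer Gram matrix `G`, Markman's
`A = (0 (ᵗG)⁻¹; -d·ᵗG 0)`, and the tree's Hermitian form `IsPolarizedWeilType.hermForm` of a polarised complex torus of Weil type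
(Literature `ComplexTorusWeilTypeHermitianForm`, Lange §7.3.3 Exercise (5)(a)). File XIIe proved that the DISCRIMINANT of every such
structure on `(X × X̂, A)` with block-diagonal rational Gram matrix `(c·G 0; 0 G₂)` — in particular `N·(±Ξ_d)` — is `[(-1)^{dim X}]`. THIS
file adds the WITNESS in the wording of [Mar25b §1.1] («`(A, η, h)` is said to be of split Weil type, if `H` has an isotropic subspace of
half the dimension»): for a Lagrangian half `{b_{inl i}}` of a symplectic basis of `η` on the lattice of `X` (tree `IsPolarizationType`),
the `K`-span `W` of the vectors `(b_{inl i}, 0) ∈ H₁(X × X̂, ℚ)` satisfies `H(W, W) = 0` and `2·dim_K W = dim_K H₁(X × X̂, ℚ)`. Mechanism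
(kernel): on vectors of the factor `X` the form is `H(x, y) = √-d·E(x, y)` (XIIe: the factor is `Re H`-isotropic), and `E = c·η` there.
No appeal to Landherr's classification (signature + discriminant), which is NOT in the tree. Nothing here says that HC, HC_CM or
HC_AV holds; nothing is a new case of anything; (S3)'s signed words and STRUCTURE D6 ∕ (S4) do not move. NO definition, NO named fact,
NO sorry; theorems only. Imports XIId + XIIe (hence XII, XIIb∕c) + Mathlib `RingTheory.Localization.Module` (`ℤ`-independent ⇒ `ℚ`-independent).
§3 composes with XIId's `isPolarizedWeilType_smul_Xi_iff` ∕ `…_neg_…`: for `η ∈ NS(X)` of type `δ` with `±η` a RIEMANN FORM (no hypothesis `h` left), Markman's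
triple `(X × X̂, N·(±Ξ_d), A)`, `N = δ₀δ_g`, HAS discriminant `[(-1)^{dim X}]` and an isotropic `K`-subspace of half the dimension.

* §1 block core: `hermFun_sumElim_inl` (`H((x,0),(y,0)) = ⟨0, ᵗx G₁ y⟩`), `hermForm_eq_zero_of_mem_span_inl` (pairwise `G₁`-isotropic
  first-block vectors span an `H`-isotropic `K`-subspace), `linearIndependent_sumElim_inl` (`ℚ`-independent first-block vectors are
  `K`-independent when `det C ≠ 0`).
* §2 Markman's triple: **`exists_isotropic_half_of_blockGram`** (general block Gram), **`exists_isotropic_half_smul_Xi`**,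
  **`exists_isotropic_half_smul_neg_Xi`** (`N·(±Ξ_d)`).
* §3 hypothesis-free (with XIId): **`discriminant_of_isRiemannForm`**, **`discriminant_of_isRiemannForm_neg`**,
  **`exists_isotropic_half_of_isRiemannForm`**, **`exists_isotropic_half_of_isRiemannForm_neg`**.
* §5 surface instance: **`isPolarizedWeilType_elliptic_Xi`**, **`discriminant_elliptic_Xi`** — `(E_τ × Ê_τ, ℚ(√-d), Ξ_d)` is polarised of
  Weil type with discriminant `[-1]` for every `τ ∈ ℍ`, `d ≥ 1` (XIId's hypotheses are inhabited; van Geemen 5.12, `n = 1`).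
* §4 cycle type (with VIII ∘ XIId): **`exists_isPolarizedWeilType_discriminant_of_analyticCycleClass_eq_smul_wedgePow`** — `[Z]_e = c·θ^{∧p}`,
  `c > 0` ⇒ for one orientation `(X × X̂, N·(±Ξ_d), A)` IS polarised of Weil type with discriminant `[(-1)^{dim X}]`.

## References
* [Markman2025SurveySecant] = [Mar25b] E. Markman, arXiv:2509.23403, §1.1 («`(A, η, h)` is said to be of split Weil type, if `H` has an
  isotropic subspace of half the dimension.»), §11.5; as typed in the cell's `lit/WEIL-DEF.md` §1.4.
* [Markman2025SecantWeil] = [Mar25] E. Markman, arXiv:2502.03415, §3.1 Lemma 3.1.3 and its proof (the `K`-basis from one factor, on which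
  `H = d√-d·Θ`); §2.4 (2.4.5)–(2.4.7) (the maximal isotropic subspaces `W₁`, `W₂`).
* [Lange2023AbelianVarietiesComplex] H. Lange, *Abelian Varieties over the Complex Numbers* (2023), §7.3.3 Exercise (5)(a); §1.5.1
  (symplectic ∕ Frobenius basis, the type of a polarisation).
* [vanGeemen1994HodgeAV] = [vG94] B. van Geemen, LNM 1594 (1994), §4 Def. 4.9, Lemma 5.2, 5.4 («split» Hermitian forms).
* [Chirka1989] E. M. Chirka, Complex Analytic Sets (1989), §14.2 Prop. 2 (Lelong positivity, as used by file VIII).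
-/

noncomputable section

open scoped ComplexOrder Manifold
open Complex Module Matrix
open Literature.Analysis.Complex Literature.Analysis.Complex.WeilOperator
open Literature.Geometry.Kaehler Literature.Geometry.Kaehler.ComplexTorus
open Literature.Geometry.Kaehler.ComplexTorus.WeilHermitian

namespace Summit.Ventures.HSemireg

namespace SecantParity

/-! ## §1 Block core: first-block vectors, isotropy, `K`-independence -/

section BlockCore

variable {ι : Type*} [Fintype ι] [DecidableEq ι] {d : ℕ}
  (G₁ G₂ B C : Matrix ι ι ℚ) (α : SqrtNegMat (ι ⊕ ι) d) (hα : α.1 = Matrix.fromBlocks 0 B C 0)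

include hα in
/-- **`H((x, 0), (y, 0)) = √-d · ᵗx G₁ y`** for vectors of the first block: the real part `E((x,0), α(y,0))` vanishes
(`α(y, 0) = (0, C y)`, `G` block diagonal). [cite: Markman2025SecantWeil, §3.1 Lemma 3.1.3 (proof)]
[cite: Lange2023AbelianVarietiesComplex, §7.3.3 Exercise (5)(a)] -/
theorem hermFun_sumElim_inl (x y : ι → ℚ) :
    hermFun (Matrix.fromBlocks G₁ 0 0 G₂) α ((WeilVec.toVec α).symm (Sum.elim x 0))
        ((WeilVec.toVec α).symm (Sum.elim y 0)) = ⟨0, x ⬝ᵥ (G₁ *ᵥ y)⟩ := by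
  apply QuadraticAlgebra.ext
  · rw [hermFun_re, LinearEquiv.apply_symm_apply, LinearEquiv.apply_symm_apply, ratForm, hα,
      Matrix.fromBlocks_mulVec, Matrix.fromBlocks_mulVec, sumElim_dotProduct_sumElim]
    simp
  · rw [hermFun_im, LinearEquiv.apply_symm_apply, LinearEquiv.apply_symm_apply, ratForm,
      Matrix.fromBlocks_mulVec, sumElim_dotProduct_sumElim]
    simp

include hα in
/-- **Pairwise `G₁`-isotropic first-block vectors span an `H`-ISOTROPIC `K`-subspace** (sesquilinearity of `H`).
[cite: Markman2025SurveySecant, §1.1] [cite: Lange2023AbelianVarietiesComplex, §7.3.3 Exercise (5)(a)] -/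
theorem hermForm_eq_zero_of_mem_span_inl [NeZero d]
    (hc : α.1ᵀ * Matrix.fromBlocks G₁ 0 0 G₂ * α.1 = (d : ℚ) • Matrix.fromBlocks G₁ 0 0 G₂)
    {κ : Type*} (w : κ → ι → ℚ) (hw : ∀ i j, w i ⬝ᵥ (G₁ *ᵥ w j) = 0) {x y : WeilVec α}
    (hx : x ∈ Submodule.span (RatSqrtNeg d) (Set.range fun i ↦ (WeilVec.toVec α).symm (Sum.elim (w i) 0)))
    (hy : y ∈ Submodule.span (RatSqrtNeg d) (Set.range fun i ↦ (WeilVec.toVec α).symm (Sum.elim (w i) 0))) :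
    hermForm (Matrix.fromBlocks G₁ 0 0 G₂) α hc x y = 0 := by
  have hgen : ∀ i j, hermForm (Matrix.fromBlocks G₁ 0 0 G₂) α hc ((WeilVec.toVec α).symm (Sum.elim (w i) 0))
      ((WeilVec.toVec α).symm (Sum.elim (w j) 0)) = 0 := fun i j ↦ by
    rw [hermForm_apply, hermFun_sumElim_inl G₁ G₂ B C α hα, hw]
    rfl
  have h1 : ∀ i, Submodule.span (RatSqrtNeg d) (Set.range fun i ↦ (WeilVec.toVec α).symm (Sum.elim (w i) 0)) ≤
      LinearMap.ker (hermForm (Matrix.fromBlocks G₁ 0 0 G₂) α hc ((WeilVec.toVec α).symm (Sum.elim (w i) 0))) :=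
    fun i ↦ Submodule.span_le.2 (by
      rintro _ ⟨j, rfl⟩
      exact (LinearMap.mem_ker).2 (hgen i j))
  have h2 : Submodule.span (RatSqrtNeg d) (Set.range fun i ↦ (WeilVec.toVec α).symm (Sum.elim (w i) 0)) ≤
      LinearMap.ker ((hermForm (Matrix.fromBlocks G₁ 0 0 G₂) α hc).flip y) :=
    Submodule.span_le.2 (by
      rintro _ ⟨i, rfl⟩
      rw [SetLike.mem_coe, LinearMap.mem_ker, LinearMap.flip_apply]
      exact (LinearMap.mem_ker).1 (h1 i hy))
  have h3 := h2 hx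
  rw [LinearMap.mem_ker, LinearMap.flip_apply] at h3
  exact h3

include hα in
/-- **`ℚ`-independent first-block vectors are `K`-independent** when `det C ≠ 0` (`Σ zᵢ (wᵢ, 0) = (Σ Re zᵢ wᵢ, C Σ Im zᵢ wᵢ)`).
[cite: Markman2025SecantWeil, §3.1 Lemma 3.1.3 (proof)] -/
theorem linearIndependent_sumElim_inl (hC : C.det ≠ 0) {κ : Type*} [Fintype κ] (w : κ → ι → ℚ)
    (hw : LinearIndependent ℚ w) :
    LinearIndependent (RatSqrtNeg d) (fun i ↦ (WeilVec.toVec α).symm (Sum.elim (w i) 0)) := by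
  rw [Fintype.linearIndependent_iff]
  intro z hz
  have h := congrArg (WeilVec.toVec α) hz
  rw [map_sum, map_zero] at h
  simp only [WeilVec.smul_def, LinearEquiv.apply_symm_apply, hα, Matrix.fromBlocks_mulVec, Matrix.zero_mulVec,
    zero_add, add_zero] at h
  have hre : ∑ x, (z x).re • w x = 0 := by
    funext k
    have hk := congrFun h (Sum.inl k)
    simpa [Finset.sum_apply] using hk
  have hC' : C *ᵥ (∑ x, (z x).im • w x) = ∑ x, (z x).im • (C *ᵥ w x) := by
    simp only [← Matrix.mulVecLin_apply, map_sum, map_smul]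
  have him' : C *ᵥ (∑ x, (z x).im • w x) = 0 := by
    rw [hC']
    funext k
    have hk := congrFun h (Sum.inr k)
    simpa [Finset.sum_apply] using hk
  have him : ∑ x, (z x).im • w x = 0 := Matrix.eq_zero_of_mulVec_eq_zero hC him'
  have hre0 := (Fintype.linearIndependent_iff.1 hw) _ hre
  have him0 := (Fintype.linearIndependent_iff.1 hw) _ him
  intro i
  exact QuadraticAlgebra.ext (hre0 i) (him0 i)

end BlockCore

/-! ## §2 Markman's triple: an `H`-isotropic `K`-subspace of half the dimension -/

section Markman

variable {ι : Type*} [Fintype ι] [DecidableEq ι] {E : Type*} [NormedAddCommGroup E] [NormedSpace ℂ E]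
  (Φ : (ι → ℝ) ≃L[ℝ] E) {η : E [⋀^Fin 2]→L[ℝ] ℝ}
  (hnd : ∀ u : E, (∀ v, η ![u, v] = 0) → u = 0) {G : Matrix ι ι ℤ}

omit [Fintype ι] [DecidableEq ι] in
/-- `ℤ → ℚ → ℝ = ℤ → ℝ` on matrices. [folklore] -/
private theorem map_intCast_map_ratCast'' {m n : Type*} (A : Matrix m n ℤ) :
    (A.map (Int.cast : ℤ → ℚ)).map (Rat.cast : ℚ → ℝ) = A.map (Int.cast : ℤ → ℝ) :=
  Matrix.ext fun i j ↦ Rat.cast_intCast (A i j)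

omit [Fintype ι] [DecidableEq ι] in
/-- The `ℚ`-vectors of (half of) a `ℤ`-basis of the lattice are `ℚ`-linearly independent.
[cite: Lange2023AbelianVarietiesComplex, §1.1.2 Prop. 1.1.10 (a) (proof, p. 20)] -/
private theorem linearIndependent_ratCast_basis_inl {g : ℕ} (b : Module.Basis (Fin g ⊕ Fin g) ℤ (ι → ℤ)) :
    LinearIndependent ℚ (fun i : Fin g ↦ fun k : ι ↦ ((b (Sum.inl i) k : ℤ) : ℚ)) := by
  rw [← LinearIndependent.iff_fractionRing ℤ ℚ]
  let c : (ι → ℤ) →ₗ[ℤ] (ι → ℚ) :=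
    { toFun := fun m i ↦ (m i : ℚ)
      map_add' := fun m n ↦ funext fun i ↦ by simp
      map_smul' := fun z m ↦ funext fun i ↦ by simp }
  have hc : LinearMap.ker c = ⊥ := by
    rw [LinearMap.ker_eq_bot]
    intro x y hxy
    funext i
    have := congrFun hxy i
    simpa [c] using this
  exact (b.linearIndependent.comp _ Sum.inl_injective).map' c hc

include hnd in
/-- **SPLIT WEIL TYPE, general block form.** For `η ∈ NS(X)` non-degenerate with integer Gram matrix `G`, Markman's `A`, and ANY
polarised-Weil-type structure `h` on `(X × X̂, A)` whose polarisation has rational Gram matrix `(c·G 0; 0 G₂)` (`c ∈ ℚ`): the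
Hermitian form of `h` has an ISOTROPIC `K`-subspace `W` with `2·dim_K W = dim_K H₁(X × X̂, ℚ)` — namely `K ⊗ L`, `L` the `ℚ`-span of
the Lagrangian half of a symplectic basis of `η`. [cite: Markman2025SurveySecant, §1.1] [cite: Markman2025SecantWeil, §3.1 Lemma 3.1.3]
[cite: Lange2023AbelianVarietiesComplex, §1.5.1 and §7.3.3 Exercise (5)(a)] -/
theorem exists_isotropic_half_of_blockGram {d : ℕ} [NeZero d] (hη : IsNSForm Φ η)
    (hG : G.map (Int.cast : ℤ → ℝ) = latticeGram Φ η) {η' : (E × (E →L⋆[ℂ] ℂ)) [⋀^Fin 2]→L[ℝ] ℝ} {n : ℕ}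
    (h : IsPolarizedWeilType (prodPeriod Φ (dualPeriod Φ)) η'
        (Matrix.fromBlocks 0 (G.transpose.map (Int.cast : ℤ → ℚ))⁻¹ ((-(d : ℚ)) • G.transpose.map (Int.cast : ℤ → ℚ)) 0)
        d n)
    {c : ℚ} {G₂ : Matrix ι ι ℚ}
    (hGq : (Matrix.fromBlocks (c • G.map (Int.cast : ℤ → ℚ)) 0 0 G₂).map (Rat.cast : ℚ → ℝ) =
      latticeGram (prodPeriod Φ (dualPeriod Φ)) η') :
    ∃ W : Submodule (RatSqrtNeg d) (WeilVec h.sqrtNeg),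
      2 * finrank (RatSqrtNeg d) W = finrank (RatSqrtNeg d) (WeilVec h.sqrtNeg) ∧
        ∀ x ∈ W, ∀ y ∈ W, h.hermForm hGq x y = 0 := by
  -- a symplectic basis of `η` on the lattice of `X`
  have hnd' : ∀ v : E, v ≠ 0 → ∃ w : E, η ![v, w] ≠ 0 := fun v hv ↦ by
    by_contra h0
    push Not at h0
    exact hv (hnd v h0)
  obtain ⟨g', δ, hδ, -⟩ := hη.exists_isPolarizationType_of_nondegenerate Φ hnd'
  have hcard : Fintype.card ι = 2 * g' := hδ.card_eq
  obtain ⟨-, bZ, hll, -, -⟩ := hδ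
  -- its Lagrangian half, as rational first-block vectors
  set w : Fin g' → ι → ℚ := fun i k ↦ ((bZ (Sum.inl i) k : ℤ) : ℚ) with hw_def
  have hGQ : (G.map (Int.cast : ℤ → ℚ)).map (Rat.cast : ℚ → ℝ) = latticeGram Φ η := by
    rw [map_intCast_map_ratCast'', hG]
  have hwG : ∀ i j, w i ⬝ᵥ ((c • G.map (Int.cast : ℤ → ℚ)) *ᵥ w j) = 0 := fun i j ↦ by
    rw [Matrix.smul_mulVec, dotProduct_smul, smul_eq_mul]
    refine mul_eq_zero_of_right _ ?_
    apply Rat.cast_injective (α := ℝ)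
    rw [ratCast_dotProduct_mulVec Φ hGQ, Rat.cast_zero, hw_def, ← intVec_eq_ratVec, ← intVec_eq_ratVec]
    exact hll i j
  have hC : ((-(d : ℚ)) • G.transpose.map (Int.cast : ℤ → ℚ)).det ≠ 0 := by
    rw [Matrix.det_smul]
    exact mul_ne_zero (pow_ne_zero _ (neg_ne_zero.2 (Nat.cast_ne_zero.2 (NeZero.ne d))))
      (isUnit_det_transposeGram Φ hnd hG).ne_zero
  have hli := linearIndependent_sumElim_inl (G.transpose.map (Int.cast : ℤ → ℚ))⁻¹
    ((-(d : ℚ)) • G.transpose.map (Int.cast : ℤ → ℚ)) h.sqrtNeg rfl hC w (linearIndependent_ratCast_basis_inl bZ)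
  refine ⟨Submodule.span (RatSqrtNeg d) (Set.range fun i ↦ (WeilVec.toVec h.sqrtNeg).symm (Sum.elim (w i) 0)), ?_,
    fun x hx y hy ↦ ?_⟩
  · rw [finrank_span_eq_card hli, Fintype.card_fin, finrank_weilVec_sum h.sqrtNeg, hcard]
  · exact hermForm_eq_zero_of_mem_span_inl (c • G.map (Int.cast : ℤ → ℚ)) G₂ (G.transpose.map (Int.cast : ℤ → ℚ))⁻¹
      ((-(d : ℚ)) • G.transpose.map (Int.cast : ℤ → ℚ)) h.sqrtNeg rfl (h.compat hGq) w hwG hx hy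

/-- **MARKMAN'S TRIPLE IS OF SPLIT WEIL TYPE ([Mar25b §1.1]) — positive orientation.** If `(X × X̂, N·Ξ_d, A)` is a polarised complex
torus of Weil type in the tree's sense (XIId: iff `η` is a Riemann form), its Hermitian form `H` (for any rational Gram matrix) has an
isotropic `K`-subspace of half the dimension. [cite: Markman2025SurveySecant, §1.1] [cite: Markman2025SecantWeil, §3.1 Lemma 3.1.3] -/
theorem exists_isotropic_half_smul_Xi {d : ℕ} [NeZero d] (hη : IsNSForm Φ η)
    (hG : G.map (Int.cast : ℤ → ℝ) = latticeGram Φ η) {N n : ℕ}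
    (h : IsPolarizedWeilType (prodPeriod Φ (dualPeriod Φ))
        (((N : ℕ) : ℝ) • prodForm ((d : ℝ) • η) (dualForm Φ hη.type_one_one hnd))
        (Matrix.fromBlocks 0 (G.transpose.map (Int.cast : ℤ → ℚ))⁻¹ ((-(d : ℚ)) • G.transpose.map (Int.cast : ℤ → ℚ)) 0)
        d n)
    {Gq : Matrix (ι ⊕ ι) (ι ⊕ ι) ℚ}
    (hGq : Gq.map (Rat.cast : ℚ → ℝ) = latticeGram (prodPeriod Φ (dualPeriod Φ))
      (((N : ℕ) : ℝ) • prodForm ((d : ℝ) • η) (dualForm Φ hη.type_one_one hnd))) :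
    ∃ W : Submodule (RatSqrtNeg d) (WeilVec h.sqrtNeg),
      2 * finrank (RatSqrtNeg d) W = finrank (RatSqrtNeg d) (WeilVec h.sqrtNeg) ∧
        ∀ x ∈ W, ∀ y ∈ W, h.hermForm hGq x y = 0 := by
  obtain rfl := ratGram_unique _ hGq (map_ratCast_blockGram Φ hη.type_one_one hnd hG N d)
  exact exists_isotropic_half_of_blockGram Φ hnd hη hG h (map_ratCast_blockGram Φ hη.type_one_one hnd hG N d)

/-- **… negative orientation** (`N·(-Ξ_d)`, polarised iff `-η` is a Riemann form): again an isotropic `K`-subspace of half the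
dimension — both orientations of every `K`-secant triple are of split Weil type. [cite: Markman2025SurveySecant, §1.1 and §11.5]
[cite: Markman2025SecantWeil, §3.1 Lemma 3.1.3] -/
theorem exists_isotropic_half_smul_neg_Xi {d : ℕ} [NeZero d] (hη : IsNSForm Φ η)
    (hG : G.map (Int.cast : ℤ → ℝ) = latticeGram Φ η) {N n : ℕ}
    (h : IsPolarizedWeilType (prodPeriod Φ (dualPeriod Φ))
        (((N : ℕ) : ℝ) • (-prodForm ((d : ℝ) • η) (dualForm Φ hη.type_one_one hnd)))
        (Matrix.fromBlocks 0 (G.transpose.map (Int.cast : ℤ → ℚ))⁻¹ ((-(d : ℚ)) • G.transpose.map (Int.cast : ℤ → ℚ)) 0)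
        d n)
    {Gq : Matrix (ι ⊕ ι) (ι ⊕ ι) ℚ}
    (hGq : Gq.map (Rat.cast : ℚ → ℝ) = latticeGram (prodPeriod Φ (dualPeriod Φ))
      (((N : ℕ) : ℝ) • (-prodForm ((d : ℝ) • η) (dualForm Φ hη.type_one_one hnd)))) :
    ∃ W : Submodule (RatSqrtNeg d) (WeilVec h.sqrtNeg),
      2 * finrank (RatSqrtNeg d) W = finrank (RatSqrtNeg d) (WeilVec h.sqrtNeg) ∧
        ∀ x ∈ W, ∀ y ∈ W, h.hermForm hGq x y = 0 := by
  obtain rfl := ratGram_unique _ hGq (map_ratCast_blockGram_neg Φ hη.type_one_one hnd hG N d)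
  exact exists_isotropic_half_of_blockGram Φ hnd hη hG h (map_ratCast_blockGram_neg Φ hη.type_one_one hnd hG N d)

/-! ## §3 Hypothesis-free form (composition with file XIId): `±η` a Riemann form ⇒ a SPLIT polarised triple -/

/-- **`η` a Riemann form ⇒ Markman's triple `(X × X̂, N·Ξ_d, A)` is a polarised complex torus of Weil type of discriminant `[(-1)^{dim X}]`.**
(`η` of type `δ = (δ₀,…,δ_g)`, `N = δ₀δ_g`, `dim X = g + 1`, any `d ≥ 1`; the structure is XIId's `isPolarizedWeilType_smul_Xi_iff`.)
[cite: Markman2025SecantWeil, §3.1 Lemma 3.1.3] [cite: vanGeemen1994HodgeAV, §4 Def. 4.9 and Lemma 5.2 (3)] -/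
theorem discriminant_of_isRiemannForm {d : ℕ} [NeZero d] (hη : IsNSForm Φ η)
    (hG : G.map (Int.cast : ℤ → ℝ) = latticeGram Φ η) {g : ℕ} {δ : Fin (g + 1) → ℕ} (hδ : IsPolarizationType Φ η δ)
    (hfin : finrank ℂ E = g + 1) (hR : IsRiemannForm Φ η) :
    ((isPolarizedWeilType_smul_Xi_iff Φ hnd hη hG hδ (Nat.pos_of_ne_zero (NeZero.ne d)) hfin).2 hR).discriminant =
      QuotientGroup.mk ((-1) ^ (g + 1)) := by
  have key := discriminant_smul_Xi Φ hnd hη hG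
    ((isPolarizedWeilType_smul_Xi_iff Φ hnd hη hG hδ (Nat.pos_of_ne_zero (NeZero.ne d)) hfin).2 hR)
  rw [hfin] at key
  exact key

/-- **`-η` a Riemann form ⇒ `(X × X̂, N·(-Ξ_d), A)` is a polarised complex torus of Weil type of discriminant `[(-1)^{dim X}]`.**
[cite: Markman2025SecantWeil, §3.1 Lemma 3.1.3] [cite: vanGeemen1994HodgeAV, §4 Def. 4.9 and Lemma 5.2 (3)] -/
theorem discriminant_of_isRiemannForm_neg {d : ℕ} [NeZero d] (hη : IsNSForm Φ η)
    (hG : G.map (Int.cast : ℤ → ℝ) = latticeGram Φ η) {g : ℕ} {δ : Fin (g + 1) → ℕ} (hδ : IsPolarizationType Φ η δ)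
    (hfin : finrank ℂ E = g + 1) (hR : IsRiemannForm Φ (-η)) :
    ((isPolarizedWeilType_smul_neg_Xi_iff Φ hnd hη hG hδ (Nat.pos_of_ne_zero (NeZero.ne d)) hfin).2 hR).discriminant =
      QuotientGroup.mk ((-1) ^ (g + 1)) := by
  have key := discriminant_smul_neg_Xi Φ hnd hη hG
    ((isPolarizedWeilType_smul_neg_Xi_iff Φ hnd hη hG hδ (Nat.pos_of_ne_zero (NeZero.ne d)) hfin).2 hR)
  rw [hfin] at key
  exact key

/-- **`η` a Riemann form ⇒ the Hermitian form of `(X × X̂, K, N·Ξ_d)` has an isotropic `K`-subspace of half the dimension** (split Weil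
type, [Mar25b §1.1]), for any rational Gram matrix. [cite: Markman2025SurveySecant, §1.1] [cite: Markman2025SecantWeil, §3.1 Lemma 3.1.3] -/
theorem exists_isotropic_half_of_isRiemannForm {d : ℕ} [NeZero d] (hη : IsNSForm Φ η)
    (hG : G.map (Int.cast : ℤ → ℝ) = latticeGram Φ η) {g : ℕ} {δ : Fin (g + 1) → ℕ} (hδ : IsPolarizationType Φ η δ)
    (hfin : finrank ℂ E = g + 1) (hR : IsRiemannForm Φ η) {Gq : Matrix (ι ⊕ ι) (ι ⊕ ι) ℚ}
    (hGq : Gq.map (Rat.cast : ℚ → ℝ) = latticeGram (prodPeriod Φ (dualPeriod Φ))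
      (((δ 0 * δ (Fin.last g) : ℕ) : ℝ) • prodForm ((d : ℝ) • η) (dualForm Φ hη.type_one_one hnd))) :
    ∃ W : Submodule (RatSqrtNeg d)
        (WeilVec ((isPolarizedWeilType_smul_Xi_iff Φ hnd hη hG hδ (Nat.pos_of_ne_zero (NeZero.ne d)) hfin).2 hR).sqrtNeg),
      2 * finrank (RatSqrtNeg d) W =
          finrank (RatSqrtNeg d) (WeilVec ((isPolarizedWeilType_smul_Xi_iff Φ hnd hη hG hδ (Nat.pos_of_ne_zero (NeZero.ne d)) hfin).2 hR).sqrtNeg) ∧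
        ∀ x ∈ W, ∀ y ∈ W,
          ((isPolarizedWeilType_smul_Xi_iff Φ hnd hη hG hδ (Nat.pos_of_ne_zero (NeZero.ne d)) hfin).2 hR).hermForm hGq x y = 0 :=
  exists_isotropic_half_smul_Xi Φ hnd hη hG _ hGq

/-- **`-η` a Riemann form ⇒ the Hermitian form of `(X × X̂, K, N·(-Ξ_d))` has an isotropic `K`-subspace of half the dimension.**
[cite: Markman2025SurveySecant, §1.1] [cite: Markman2025SecantWeil, §3.1 Lemma 3.1.3] -/
theorem exists_isotropic_half_of_isRiemannForm_neg {d : ℕ} [NeZero d] (hη : IsNSForm Φ η)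
    (hG : G.map (Int.cast : ℤ → ℝ) = latticeGram Φ η) {g : ℕ} {δ : Fin (g + 1) → ℕ} (hδ : IsPolarizationType Φ η δ)
    (hfin : finrank ℂ E = g + 1) (hR : IsRiemannForm Φ (-η)) {Gq : Matrix (ι ⊕ ι) (ι ⊕ ι) ℚ}
    (hGq : Gq.map (Rat.cast : ℚ → ℝ) = latticeGram (prodPeriod Φ (dualPeriod Φ))
      (((δ 0 * δ (Fin.last g) : ℕ) : ℝ) • (-prodForm ((d : ℝ) • η) (dualForm Φ hη.type_one_one hnd)))) :
    ∃ W : Submodule (RatSqrtNeg d)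
        (WeilVec ((isPolarizedWeilType_smul_neg_Xi_iff Φ hnd hη hG hδ (Nat.pos_of_ne_zero (NeZero.ne d)) hfin).2 hR).sqrtNeg),
      2 * finrank (RatSqrtNeg d) W =
          finrank (RatSqrtNeg d) (WeilVec ((isPolarizedWeilType_smul_neg_Xi_iff Φ hnd hη hG hδ (Nat.pos_of_ne_zero (NeZero.ne d)) hfin).2 hR).sqrtNeg) ∧
        ∀ x ∈ W, ∀ y ∈ W,
          ((isPolarizedWeilType_smul_neg_Xi_iff Φ hnd hη hG hδ (Nat.pos_of_ne_zero (NeZero.ne d)) hfin).2 hR).hermForm hGq x y = 0 :=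
  exists_isotropic_half_smul_neg_Xi Φ hnd hη hG _ hGq

end Markman

/-! ## §4 Cycle-type secant objects: a polarised Weil-type triple of discriminant `(-1)^{dim X}` (split by §2; with files VIII and XIId) -/

section CycleType

universe u

variable {κ : Type*} [Fintype κ] [DecidableEq κ] {V : Type u} [NormedAddCommGroup V] [InnerProductSpace ℂ V]
  [FiniteDimensional ℂ V] [MeasurableSpace V] [BorelSpace V] (Ψ : (κ → ℝ) ≃L[ℝ] V) {n dZ : ℕ} (e : Fin n ≃ κ)
  {θ : V [⋀^Fin 2]→L[ℝ] ℝ} (hnd : ∀ u : V, (∀ v, θ ![u, v] = 0) → u = 0) {G : Matrix κ κ ℤ}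

/-- **Every CYCLE-TYPE secant direction yields a polarised abelian variety of Weil type with discriminant `[(-1)^{g+1}]`** (split by §2,
`exists_isotropic_half_smul_Xi` ∕ `…_neg_Xi`, which this statement does not restate). `X = V/Ψ(ℤ^κ)`, `Z ⊂ X` closed analytic of
pure dimension `dZ ≥ 1`, positively oriented `e` (`rk Λ = 2dZ + 2p`), `[Z]_e = c • θ^{∧p}` with `c > 0`, `p ≥ 1`, `θ ∈ NS(X)` non-degenerate of type `δ` with
integer Gram matrix `G`, `dim X = g + 1`, `d ≥ 1`, `N = δ₀δ_g`: for ONE of the two orientations `±Ξ_d` (the negative one, or — `p` even — the positive one)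
`(X × X̂, N·(±Ξ_d), A)` IS a polarised complex torus of Weil type (file VIII's Lelong dichotomy + file XIId) and its discriminant is `[(-1)^{g+1}]` (file XIIe):
Markman's standing assumption holds automatically for cycle-type objects, on the split component. [cite: Markman2025SecantWeil, §2.4 Prop. 2.4.4 and §3.1 Lemma 3.1.3]
[cite: Chirka1989, §14.2 Prop. 2] [cite: vanGeemen1994HodgeAV, §4 Def. 4.9 and Lemma 5.2 (3)] -/
theorem exists_isPolarizedWeilType_discriminant_of_analyticCycleClass_eq_smul_wedgePow {p : ℕ} (h : 2 * dZ + 2 * p = n)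
    {Z : Set (ComplexTorus Ψ)} (hZ : HasPureDim 𝓘(ℂ, V) Z dZ) (he : orientationSign Ψ e = 1) (hp : 1 ≤ p) (hdZ : 1 ≤ dZ)
    (hθ : IsNSForm Ψ θ) (hG : G.map (Int.cast : ℤ → ℝ) = latticeGram Ψ θ) {c : ℝ} (hc : 0 < c)
    (hcl : analyticCycleClass Ψ e h hZ = (c : ℂ) • wedgePow (ofRealForm θ) p)
    {g : ℕ} {δ : Fin (g + 1) → ℕ} (hδ : IsPolarizationType Ψ θ δ) (hfin : finrank ℂ V = g + 1) {d : ℕ} [NeZero d] :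
    (∃ hW : IsPolarizedWeilType (prodPeriod Ψ (dualPeriod Ψ))
        (((δ 0 * δ (Fin.last g) : ℕ) : ℝ) • (-prodForm ((d : ℝ) • θ) (dualForm Ψ hθ.type_one_one hnd)))
        (Matrix.fromBlocks 0 (G.transpose.map (Int.cast : ℤ → ℚ))⁻¹ ((-(d : ℚ)) • G.transpose.map (Int.cast : ℤ → ℚ)) 0) d (g + 1),
        hW.discriminant = QuotientGroup.mk ((-1) ^ (g + 1))) ∨
      (Even p ∧ ∃ hW : IsPolarizedWeilType (prodPeriod Ψ (dualPeriod Ψ))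
        (((δ 0 * δ (Fin.last g) : ℕ) : ℝ) • prodForm ((d : ℝ) • θ) (dualForm Ψ hθ.type_one_one hnd))
        (Matrix.fromBlocks 0 (G.transpose.map (Int.cast : ℤ → ℚ))⁻¹ ((-(d : ℚ)) • G.transpose.map (Int.cast : ℤ → ℚ)) 0) d (g + 1),
        hW.discriminant = QuotientGroup.mk ((-1) ^ (g + 1))) := by
  have hd : 0 < d := Nat.pos_of_ne_zero (NeZero.ne d)
  rcases isRiemannForm_smul_neg_Xi_or_of_analyticCycleClass_eq_smul_wedgePow Ψ e hnd h hZ he hp hdZ hθ hc hcl hδ hd with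
    hneg | ⟨hev, hpos⟩
  · have hR : IsRiemannForm Ψ (-θ) := (isRiemannForm_smul_neg_Xi_iff Ψ hθ.type_one_one hnd hθ hδ hd).1 hneg
    exact Or.inl ⟨(isPolarizedWeilType_smul_neg_Xi_iff Ψ hnd hθ hG hδ hd hfin).2 hR,
      discriminant_of_isRiemannForm_neg Ψ hnd hθ hG hδ hfin hR⟩
  · have hR : IsRiemannForm Ψ θ := (isRiemannForm_smul_Xi_iff Ψ hθ.type_one_one hnd hθ hδ hd).1 hpos
    exact Or.inr ⟨hev, (isPolarizedWeilType_smul_Xi_iff Ψ hnd hθ hG hδ hd hfin).2 hR,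
      discriminant_of_isRiemannForm Ψ hnd hθ hG hδ hfin hR⟩

end CycleType

/-! ## §5 Non-vacuity in the surface case: `(E_τ × Ê_τ, ℚ(√-d), Ξ_d)` is polarised of SPLIT Weil type, discriminant `[-1]` -/

section Elliptic

/-- **For every `τ ∈ ℍ` and every `d ≥ 1`, Markman's triple on the elliptic curve `E_τ = ℂ/(ℤτ + ℤ)` with its principal form
`E(v, w) = Im(v w̄)/Im τ` (type `(1)`, Gram matrix `J = (0 1; -1 0)`, `N = 1`) — `(E_τ × Ê_τ, Ξ_d = d·E ⊞ E^*, A = (0 (ᵗJ)⁻¹; -d·ᵗJ 0))` — IS a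
polarised complex torus of Weil type** (an inhabited instance of XIId's hypotheses; for `d = 1` compare van Geemen's Example 5.12 with `n = 1`).
[cite: vanGeemen1994HodgeAV, §4 Def. 4.9 and 5.12] [cite: Lange2023AbelianVarietiesComplex, §2.1.1 Example 2.1.3] -/
theorem isPolarizedWeilType_elliptic_Xi {τ : ℂ} (hτ : 0 < τ.im) {d : ℕ} [NeZero d] :
    IsPolarizedWeilType (prodPeriod (ellipticPeriod hτ.ne') (dualPeriod (ellipticPeriod hτ.ne')))
      (((1 * 1 : ℕ) : ℝ) • prodForm ((d : ℝ) • ellipticForm hτ.ne')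
        (dualForm (ellipticPeriod hτ.ne') (isRiemannForm_ellipticForm hτ).isNSForm.type_one_one
          (isRiemannForm_ellipticForm hτ).nondegenerate))
      (Matrix.fromBlocks 0 (ellipticGram.transpose.map (Int.cast : ℤ → ℚ))⁻¹
        ((-(d : ℚ)) • ellipticGram.transpose.map (Int.cast : ℤ → ℚ)) 0) d (0 + 1) :=
  (isPolarizedWeilType_smul_Xi_iff (ellipticPeriod hτ.ne') (isRiemannForm_ellipticForm hτ).nondegenerate
    (isRiemannForm_ellipticForm hτ).isNSForm (ellipticGram_map_intCast hτ.ne') (isPolarizationType_elliptic hτ.ne')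
    (Nat.pos_of_ne_zero (NeZero.ne d)) (by rw [Module.finrank_self])).2 (isRiemannForm_ellipticForm hτ)

/-- **… and every such structure has discriminant `[-1] = [(-1)¹]`: a polarised abelian SURFACE of SPLIT Weil type for `K = ℚ(√-d)`,**
every `τ`, every `d` (the EllipticSquare file of the Literature layer stops before «`det H`»; here it is the class of `-1`).
[cite: Markman2025SecantWeil, §3.1 Lemma 3.1.3] [cite: vanGeemen1994HodgeAV, Lemma 5.2 (3) and 5.12] -/
theorem discriminant_elliptic_Xi {τ : ℂ} (hτ : 0 < τ.im) {d : ℕ} [NeZero d] {n : ℕ}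
    (h : IsPolarizedWeilType (prodPeriod (ellipticPeriod hτ.ne') (dualPeriod (ellipticPeriod hτ.ne')))
      (((1 * 1 : ℕ) : ℝ) • prodForm ((d : ℝ) • ellipticForm hτ.ne')
        (dualForm (ellipticPeriod hτ.ne') (isRiemannForm_ellipticForm hτ).isNSForm.type_one_one
          (isRiemannForm_ellipticForm hτ).nondegenerate))
      (Matrix.fromBlocks 0 (ellipticGram.transpose.map (Int.cast : ℤ → ℚ))⁻¹
        ((-(d : ℚ)) • ellipticGram.transpose.map (Int.cast : ℤ → ℚ)) 0) d n) :
    h.discriminant = QuotientGroup.mk (-1) := by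
  have key := discriminant_smul_Xi (ellipticPeriod hτ.ne') (isRiemannForm_ellipticForm hτ).nondegenerate
    (isRiemannForm_ellipticForm hτ).isNSForm (ellipticGram_map_intCast hτ.ne') h
  rw [Module.finrank_self, pow_one] at key
  exact key

end Elliptic

end SecantParity

end Summit.Ventures.HSemireg
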